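import Summits.QuantumFields.BalabanUV.Beta.FP.CoarseJetOrderTwoGradedCombJunctionLive
import Summits.QuantumFields.BalabanUV.Beta.CombHId2TorusRecord
import Summits.QuantumFields.BalabanUV.Beta.FP.NestedStepLawTorusInstance

/-!
# `BalabanUV.Beta.FP.CoarseJetOrderTwoGradedCombJunctionRecord` — road «FP» (binder row D1), ROUTE T, junction J2 (record half, part a) of leaf-05's W-1:
# **an2's CROWN CONTRACTED ALONG A COARSE DIRECTION** — `Σ_{b̄ b̄′} v_{b̄} v_{b̄′} · perF M′ (dper M′ (T2_{j+1} b̄ b̄′ copy-summed))|ff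
# `= (cE₂·wV4 (j+1)) · (2 • (Â·D̂_v·Â·D̂_v·Â) − Â·Ŵ_{vv}·Â)(coarse slots) + (cB·wB2 (j+1)) · (the contracted border term)`

WHY.  an2's crown `CombHId2TorusRecord.perF_dper_tsum_T2comb_succ_inl_inl` (p358222 ✓) is stated per ORDERED pair of coarse bonds; the door's `hId₂` is a
statement along a direction.  This file contracts the crown with `v ⊗ v` (J2-live §5 `responseWord_bilinear`) — the right side is then EXACTLY the `X := D̂_v`,
`Y := Ŵ_{vv}` response word that J2-live §4 `torus_thetaWord_eq_responseWord_comb` turns into the door's polynomial once the eight block letters (an2's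
«letters 2d»: zero `μμ` blocks, odd ∕ even placements) are supplied.  [folklore] `Finset` linearity BY NAME; no `def`, no `def … : Prop`, nothing cited, 0 sorry.
HONEST DEPENDENCY (page 1, mandatory): continuum YM on T⁴ ⇐ BetaPertH ∧ nine spine estimates (0/9 proved); BetaPertH ⇐ (D1) ∧ (D4) ∧ CAP+tail;
G-an2-4 gates asym, D1 and NE2/3/4.  Discharges NO binder of row D1; NOT the dictionary's `hId₂`, NOT (J-a), NOT (T-ID), NOT SDF, NOT D1, NEVER «G-an2-4 closed»,
NOT BetaPertH, NOT continuum, NOT Clay; 0 estimates.  «not in print; our bookkeeping».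
Unit `b2b-balaban-beta-d1-formalise-leaf-05` (gen 35), 2026-08-23; no existing file touched.
-/

noncomputable section

open scoped BigOperators Matrix

namespace Summit.QuantumFields.BalabanUV.Beta.FP.CoarseJetOrderTwoGradedCombJunctionRecord

open Matrix
open Literature.MathematicalPhysics.QuantumFieldTheory.Balaban1983to89
open Literature.MathematicalPhysics.QuantumFieldTheory.Balaban1983to89.Beta
open B4TorusKernel.MultiPeriod (translate)
open ExpKernelCalculus (MKer)
open AffineAveraging (Site)
open OneStepResolventKernel (Fib)
open BalabanStepW2 (wV4 wB2 M2Of)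
open SecondOrderResponse (dM W2SymOfK)
open Summit.QuantumFields.BalabanUV.Beta.SpineRooted (T2RecOf)
open Summit.QuantumFields.BalabanUV.Beta.FP.KernelPeriodisationFib (Idx perF)
open Summit.QuantumFields.BalabanUV.Beta.FP.KernelPeriodisationFibLoc (dper)
open Summit.QuantumFields.BalabanUV.Beta.FP.TorusGaugeCovariancePairing (wrapPt)
open Summit.QuantumFields.BalabanUV.Beta.SymmetrisedStepJets (SymTables)
open Summit.QuantumFields.BalabanUV.Beta.CombChartStepJets (GcombSh SpureCombOf)
open B6Lemma24Torus (pbox)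
open Summit.QuantumFields.BalabanUV.Beta.CombHId2TorusRecord (perF_dper_tsum_T2comb_succ_inl_inl)
open Summit.QuantumFields.BalabanUV.Beta.FP.CoarseJetOrderTwoGradedCombJunctionLive (responseWord_bilinear)

/-! ## §0 Generic: `submatrix` of weighted sums -/

section Generic

/-- [folklore] `submatrix` is linear: weighted sums. -/
theorem submatrix_sum_smul {ι α β γ : Type*} [Fintype γ] (A : γ → Matrix ι ι ℝ) (c : γ → ℝ) (f : α → ι) (g : β → ι) :
    (∑ b, c b • A b).submatrix f g = ∑ b, c b • (A b).submatrix f g := by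
  ext i k
  simp only [Matrix.submatrix_apply, Matrix.sum_apply, Matrix.smul_apply]

/-- [folklore] `submatrix` is linear: doubly weighted sums. -/
theorem submatrix_sum_sum_smul {ι α β γ : Type*} [Fintype γ] (A : γ → γ → Matrix ι ι ℝ) (c : γ → γ → ℝ) (f : α → ι) (g : β → ι) :
    (∑ b, ∑ b', c b b' • A b b').submatrix f g = ∑ b, ∑ b', c b b' • (A b b').submatrix f g := by
  ext i k
  simp only [Matrix.submatrix_apply, Matrix.sum_apply, Matrix.smul_apply]


/-- [folklore] **THE RESPONSE BORDER's SHARE IS ANTISYMMETRIC**: if `Θᴸ = −Θᵀ` and `Ŝᵀ = Ŝ` (the parity-even `Â`, (P0)), then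
`(Θᴸ·Qᶻᵀ·Ŝ + Ŝ·Qᶻ·Θ)ᵀ = −(Θᴸ·Qᶻᵀ·Ŝ + Ŝ·Qᶻ·Θ)` — invisible to any symmetric reading of `hId₂`'s `μμ` block. -/
theorem responseBorder_transpose {ν μ : Type*} [Fintype ν] [Fintype μ] (Θ : Matrix ν μ ℝ) (ΘL : Matrix μ ν ℝ) (Ŝ : Matrix μ μ ℝ)
    (Qz : Matrix μ ν ℝ) (hΘL : ΘL = -Θᵀ) (hŜ : Ŝᵀ = Ŝ) :
    (ΘL * Qzᵀ * Ŝ + Ŝ * Qz * Θ)ᵀ = -(ΘL * Qzᵀ * Ŝ + Ŝ * Qz * Θ) := by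
  subst hΘL
  rw [Matrix.transpose_add, Matrix.transpose_mul, Matrix.transpose_mul, Matrix.transpose_mul, Matrix.transpose_mul, Matrix.transpose_transpose,
    hŜ, Matrix.transpose_neg, Matrix.transpose_transpose]
  simp only [Matrix.neg_mul, Matrix.mul_neg, neg_neg, neg_add, Matrix.mul_assoc]
  abel

end Generic

variable {d : ℕ} (M : Fin (d + 1) → ℕ) [∀ μ, NeZero (M μ)]
variable {Lc : ℕ} [NeZero Lc] {M' : Fin (d + 1) → ℕ} [∀ μ, NeZero (M' μ)] (tabs : SymTables d Lc) (cE cVH cΛ cE₂ cB : ℝ)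
  (T : Fin 4 → Fin 4 → Fin 4 → Fin 4 → ℝ)

/-- **[folklore] `sum_sum_perF_dper_tsum_T2comb_succ_inl_inl` — an2's CROWN CONTRACTED WITH `v ⊗ v`** (`v` any weight on the coarse bonds `pbox M′ × Fin (d+1)`;
`D̂_v := Σ_{b̄} v_{b̄} • D̂_{b̄}`, `Ŵ_{vv} := Σ_{b̄ b̄′} (v_{b̄} v_{b̄′}) • Ŵ_{b̄b̄′}`): the `v ⊗ v`-contracted coarse `ff` entries of the periodised level-`(j+1)`
second-order table `=` `(cE₂·wV4 (j+1)) ·` the `(2 • (Â·D̂_v·Â·D̂_v·Â) − Â·Ŵ_{vv}·Â)` entry at the two coarse slots `+ (cB·wB2 (j+1)) ·` the contracted border term. -/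
theorem sum_sum_perF_dper_tsum_T2comb_succ_inl_inl (hM : ∀ i, M i = Lc * M' i) (j : ℕ) (v : ↥(pbox M') × Fin (d + 1) → ℝ)
    (y₁ y₂ : ↥(pbox M')) (m₁ m₂ : Fin (d + 1)) :
    ∑ b : ↥(pbox M') × Fin (d + 1), ∑ b' : ↥(pbox M') × Fin (d + 1), (v b * v b')
        * perF M' (dper M' (fun x z a c => ∑' n, T2RecOf d Lc (GcombSh Lc) (SpureCombOf tabs cE cVH cΛ) tabs.M cE₂ cB T tabs.vh₂S tabs.mixFF (j + 1)
            b.2 (b.1 : Site (d + 1)) b'.2 (translate M' (b'.1 : Site (d + 1)) n) x z a c)) (y₁, Sum.inl m₁) (y₂, Sum.inl m₂)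
      = (cE₂ * wV4 d Lc (j + 1))
          * ((2 : ℝ) • (perF M (GcombSh (d := d) Lc j)
                * (∑ b : ↥(pbox M') × Fin (d + 1), v b • perF M (dM (GcombSh (d := d) Lc j) Lc (fun κ u => dper M (SpureCombOf tabs cE cVH cΛ j κ u))
                    (fun ρ w => dper M (tabs.M j ρ w)) b.2 (b.1 : Site (d + 1))))
                * perF M (GcombSh (d := d) Lc j)
                * (∑ b : ↥(pbox M') × Fin (d + 1), v b • perF M (dM (GcombSh (d := d) Lc j) Lc (fun κ u => dper M (SpureCombOf tabs cE cVH cΛ j κ u))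
                    (fun ρ w => dper M (tabs.M j ρ w)) b.2 (b.1 : Site (d + 1))))
                * perF M (GcombSh (d := d) Lc j))
              - perF M (GcombSh (d := d) Lc j)
                * (∑ b : ↥(pbox M') × Fin (d + 1), ∑ b' : ↥(pbox M') × Fin (d + 1), (v b * v b')
                    • perF M (W2SymOfK (GcombSh (d := d) Lc j) Lc (fun κ u => dper M (SpureCombOf tabs cE cVH cΛ j κ u)) (fun ρ w => dper M (tabs.M j ρ w))
                        (fun κ u κ' u' => dper M (fun x z a c => ∑' n : Site (d + 1),
                          T2RecOf d Lc (GcombSh Lc) (SpureCombOf tabs cE cVH cΛ) tabs.M cE₂ cB T tabs.vh₂S tabs.mixFF j κ u κ' (translate M u' n) x z a c))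
                        (fun κ u ρ w => dper M (fun x z a c => ∑' n : Site (d + 1), M2Of d Lc tabs.mixFF j κ u ρ (translate M' w n) x z a c))
                        b.2 (b.1 : Site (d + 1)) b'.2 (b'.1 : Site (d + 1))))
                * perF M (GcombSh (d := d) Lc j))
            (wrapPt M ((Lc : ℤ) • (y₁ : Site (d + 1))), Sum.inr m₁) (wrapPt M ((Lc : ℤ) • (y₂ : Site (d + 1))), Sum.inr m₂)
        + (cB * wB2 d Lc (j + 1))
          * ∑ b : ↥(pbox M') × Fin (d + 1), ∑ b' : ↥(pbox M') × Fin (d + 1), (v b * v b')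
              * perF M' (dper M' (fun x z a c => ∑' n, tabs.vh₂S b.2 (b.1 : Site (d + 1)) b'.2 (translate M' (b'.1 : Site (d + 1)) n) x z a c))
                  (y₁, Sum.inl m₁) (y₂, Sum.inl m₂) := by
  -- the crown, pair by pair
  rw [Finset.sum_congr rfl fun b _ => Finset.sum_congr rfl fun b' _ =>
    show (v b * v b') * _ = (v b * v b') * _ from by rw [perF_dper_tsum_T2comb_succ_inl_inl M tabs cE cVH cΛ cE₂ cB T hM j b.2 (b.1 : Site (d + 1)) b'.2
      (b'.1 : Site (d + 1)) y₁ y₂ m₁ m₂]]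
  -- linearity, and §5 for the response words
  rw [← responseWord_bilinear]
  simp only [mul_add, Finset.sum_add_distrib, Matrix.sum_apply, Matrix.smul_apply, smul_eq_mul, Finset.mul_sum]
  congr 1
  · exact Finset.sum_congr rfl fun b _ => Finset.sum_congr rfl fun b' _ => by ring
  · exact Finset.sum_congr rfl fun b _ => Finset.sum_congr rfl fun b' _ => by ring

/-! ## §2 The door's `hId₂` at the record, MODULO an2's block letters («letters 2d», displayed as sockets) -/

section Assembly

open Literature.Probability.LatticeModels (Torus.proj)
open AveragingContoursRooted (ctr)
open B5Prop11Plancherel (fine)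
open Summit.QuantumFields.BalabanUV.Beta.AxialDressingRooted (axEc)
open Summit.QuantumFields.BalabanUV.Beta.FP.TorusGaugeCovarianceCoarse (coarsePt coarsePt_coe)
open Summit.QuantumFields.BalabanUV.Beta.FP.TorusGaugeCovariancePairing (wrapPt_of_mem)
open Summit.QuantumFields.BalabanUV.Beta.FP.NestedStepLawTorusInstance (coarseSlot_injective coarseSlot_range)
open Summit.QuantumFields.BalabanUV.Beta.FP.CoarseJetOrderTwoGradedCombJunctionLive (torus_thetaWord_eq_responseWord_comb torus_sandwich_symmJet_comb)

/-- [folklore] U21's coarse slot IS an2's wrapped coarse point: `wrapPt (fine Lc M′) (Lc • y) = coarsePt M′ Lc y`. -/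
theorem wrapPt_zsmul_eq_coarsePt (y : ↥(pbox M')) : wrapPt (fine Lc M') ((Lc : ℤ) • (y : Site (d + 1))) = coarsePt M' Lc y := by
  rw [← coarsePt_coe M' Lc y, wrapPt_of_mem]

set_option synthInstance.maxSize 1024 in
set_option maxHeartbeats 800000 in
/-- **[folklore] `torus_thetaWord_record_comb` — THE DOOR's `hId₂` AT THE CHART-(III′) RECORD, MODULO an2's BLOCK LETTERS, THE SECOND-ORDER WORD SPLIT `Ŵ = Ŵ^{slots} + Ẑ` (W-an2-g45-9: the response word `Ẑ` is a parity-ODD first-order word along the second-response direction, symmetric-twin border; the slot words are anti-twin).**  On the fine box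
`F = fine Lc M′` with U21's coarse slots `fμ a := (coarsePt M′ Lc a.1, inr a.2)` and field slots `fs b := (b.1, inl b.2)`; the door's `Θ Θᴸ Ŝ Γ̂` binders
(`CoarseJetOrderTwoGradedComb`, masks VERBATIM); an2's first- and second-order torus words `D̂_{b̄} := perF F (dM G Lc S^per_j M^per_j b̄)`,
`Ŵ_{b̄b̄′} := perF F (W2SymOfK … b̄ b̄′)` (`CombHId2TorusRecord`'s spelling, `hDh hWh`), any split `Ŵ = Ŵ^{slots} + Ẑ` (`hsplit`); the door's jets along the coarse
direction `v` READ as `H₁ := D̂_v∘(fs,fs)`, `Q₁₁ := D̂_v∘(fμ,fs)`, `H₂ := Ŵ^{slots}_{vv}∘(fs,fs)`, `Q₁₂ := Ŵ^{slots}_{vv}∘(fμ,fs)`, `Hᶻ := Ẑ_{vv}∘(fs,fs)`, `Qᶻ := Ẑ_{vv}∘(fμ,fs)`;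
and SIX SOCKETS (an2's «letters 2d»): zero `μμ` blocks, `D̂` and `Ẑ` symmetric-twin ((L2a), `parityOdd_dM`), `Ŵ^{slots}` anti-twin ((L2b-slots)).  THEN for all coarse slots:
`(cE₂·wV4 (j+1)) · (P(Θ, Θᴸ, Ŝ, Γ̂; H₁, H₂, Q₁₁, Q₁₂) − (Θᴸ·Hᶻ·Θ + Θᴸ·Qᶻᵀ·Ŝ + Ŝ·Qᶻ·Θ)) a₁ a₂ + (cB·wB2 (j+1)) · (v ⊗ v-contracted periodised border)∘(coarse ff) a₁ a₂`
`= Σ_{b̄ b̄′} v_{b̄} v_{b̄′} · perF M′ (dper M′ (T2_{j+1} b̄ b̄′ copy-summed)) (a₁.1, inl a₁.2) (a₂.1, inl a₂.2)` — `hId₂` with `c • H′₂` READ; the response border's share `−(Θᴸ·Qᶻᵀ·Ŝ + Ŝ·Qᶻ·Θ)` is ANTISYMMETRIC under (P0) (`Θᴸ = −Θᵀ`, `Ŝᵀ = Ŝ`), invisible to the symmetric `H′₂`. -/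
theorem torus_thetaWord_record_comb (j : ℕ)
    {Θ : Matrix (↥(pbox (fine Lc M')) × Fin (d + 1)) (↥(pbox M') × Fin (d + 1)) ℝ}
    {ΘL : Matrix (↥(pbox M') × Fin (d + 1)) (↥(pbox (fine Lc M')) × Fin (d + 1)) ℝ} {Ŝ : Matrix (↥(pbox M') × Fin (d + 1)) (↥(pbox M') × Fin (d + 1)) ℝ}
    {Γc : Matrix (↥(pbox (fine Lc M')) × Fin (d + 1)) (↥(pbox (fine Lc M')) × Fin (d + 1)) ℝ}
    (hΘ : Θ = Matrix.of fun (b : ↥(pbox (fine Lc M')) × Fin (d + 1)) (a : ↥(pbox M') × Fin (d + 1)) =>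
        axEc (ctr (d + 1) Lc) Lc (b.1 : Site (d + 1)) (b.1 : Site (d + 1)) (Sum.inl b.2) (Sum.inl b.2)
          * perF (fine Lc M') (GcombSh (d := d) Lc j) (b.1, Sum.inl b.2) (coarsePt M' Lc a.1, Sum.inr a.2))
    (hΘL : ΘL = Matrix.of fun (a : ↥(pbox M') × Fin (d + 1)) (b : ↥(pbox (fine Lc M')) × Fin (d + 1)) =>
        axEc (ctr (d + 1) Lc) Lc (b.1 : Site (d + 1)) (b.1 : Site (d + 1)) (Sum.inl b.2) (Sum.inl b.2)
          * perF (fine Lc M') (GcombSh (d := d) Lc j) (coarsePt M' Lc a.1, Sum.inr a.2) (b.1, Sum.inl b.2))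
    (hŜ : Ŝ = (perF (fine Lc M') (GcombSh (d := d) Lc j)).submatrix
        (fun a : ↥(pbox M') × Fin (d + 1) => ((coarsePt M' Lc a.1, Sum.inr a.2) : Idx (fine Lc M') (Fib d)))
        (fun a : ↥(pbox M') × Fin (d + 1) => ((coarsePt M' Lc a.1, Sum.inr a.2) : Idx (fine Lc M') (Fib d))))
    (hΓc : Γc = Matrix.of fun (b b' : ↥(pbox (fine Lc M')) × Fin (d + 1)) =>
        axEc (ctr (d + 1) Lc) Lc (b.1 : Site (d + 1)) (b.1 : Site (d + 1)) (Sum.inl b.2) (Sum.inl b.2)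
          * (axEc (ctr (d + 1) Lc) Lc (b'.1 : Site (d + 1)) (b'.1 : Site (d + 1)) (Sum.inl b'.2) (Sum.inl b'.2)
            * perF (fine Lc M') (GcombSh (d := d) Lc j) (b.1, Sum.inl b.2) (b'.1, Sum.inl b'.2)))
    {Dh : ↥(pbox M') × Fin (d + 1) → Matrix (Idx (fine Lc M') (Fib d)) (Idx (fine Lc M') (Fib d)) ℝ}
    (hDh : Dh = fun b => perF (fine Lc M') (dM (GcombSh (d := d) Lc j) Lc (fun κ u => dper (fine Lc M') (SpureCombOf tabs cE cVH cΛ j κ u))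
        (fun ρ w => dper (fine Lc M') (tabs.M j ρ w)) b.2 (b.1 : Site (d + 1))))
    {Wh : ↥(pbox M') × Fin (d + 1) → ↥(pbox M') × Fin (d + 1) → Matrix (Idx (fine Lc M') (Fib d)) (Idx (fine Lc M') (Fib d)) ℝ}
    (hWh : Wh = fun b b' => perF (fine Lc M') (W2SymOfK (GcombSh (d := d) Lc j) Lc (fun κ u => dper (fine Lc M') (SpureCombOf tabs cE cVH cΛ j κ u))
        (fun ρ w => dper (fine Lc M') (tabs.M j ρ w))
        (fun κ u κ' u' => dper (fine Lc M') (fun x z a c => ∑' n : Site (d + 1),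
          T2RecOf d Lc (GcombSh Lc) (SpureCombOf tabs cE cVH cΛ) tabs.M cE₂ cB T tabs.vh₂S tabs.mixFF j κ u κ' (translate (fine Lc M') u' n) x z a c))
        (fun κ u ρ w => dper (fine Lc M') (fun x z a c => ∑' n : Site (d + 1), M2Of d Lc tabs.mixFF j κ u ρ (translate M' w n) x z a c))
        b.2 (b.1 : Site (d + 1)) b'.2 (b'.1 : Site (d + 1))))
    {Ws Wz : ↥(pbox M') × Fin (d + 1) → ↥(pbox M') × Fin (d + 1) → Matrix (Idx (fine Lc M') (Fib d)) (Idx (fine Lc M') (Fib d)) ℝ}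
    (hsplit : ∀ b b', Wh b b' = Ws b b' + Wz b b')
    -- SOCKETS (an2's «letters 2d»): zero `μμ` blocks at the coarse slots; `D̂`, `Ẑ` symmetric-twin (parity-odd), `Ŵ^{slots}` anti-twin (parity-even)
    (hDmm : ∀ b, (Dh b).submatrix (fun a : ↥(pbox M') × Fin (d + 1) => ((coarsePt M' Lc a.1, Sum.inr a.2) : Idx (fine Lc M') (Fib d)))
        (fun a : ↥(pbox M') × Fin (d + 1) => ((coarsePt M' Lc a.1, Sum.inr a.2) : Idx (fine Lc M') (Fib d))) = 0)
    (hDfm : ∀ b, (Dh b).submatrix (fun b : ↥(pbox (fine Lc M')) × Fin (d + 1) => ((b.1, Sum.inl b.2) : Idx (fine Lc M') (Fib d)))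
        (fun a : ↥(pbox M') × Fin (d + 1) => ((coarsePt M' Lc a.1, Sum.inr a.2) : Idx (fine Lc M') (Fib d)))
        = ((Dh b).submatrix (fun a : ↥(pbox M') × Fin (d + 1) => ((coarsePt M' Lc a.1, Sum.inr a.2) : Idx (fine Lc M') (Fib d)))
            (fun b : ↥(pbox (fine Lc M')) × Fin (d + 1) => ((b.1, Sum.inl b.2) : Idx (fine Lc M') (Fib d))))ᵀ)
    (hWmm : ∀ b b', (Ws b b').submatrix (fun a : ↥(pbox M') × Fin (d + 1) => ((coarsePt M' Lc a.1, Sum.inr a.2) : Idx (fine Lc M') (Fib d)))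
        (fun a : ↥(pbox M') × Fin (d + 1) => ((coarsePt M' Lc a.1, Sum.inr a.2) : Idx (fine Lc M') (Fib d))) = 0)
    (hWfm : ∀ b b', (Ws b b').submatrix (fun b : ↥(pbox (fine Lc M')) × Fin (d + 1) => ((b.1, Sum.inl b.2) : Idx (fine Lc M') (Fib d)))
        (fun a : ↥(pbox M') × Fin (d + 1) => ((coarsePt M' Lc a.1, Sum.inr a.2) : Idx (fine Lc M') (Fib d)))
        = -((Ws b b').submatrix (fun a : ↥(pbox M') × Fin (d + 1) => ((coarsePt M' Lc a.1, Sum.inr a.2) : Idx (fine Lc M') (Fib d)))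
            (fun b : ↥(pbox (fine Lc M')) × Fin (d + 1) => ((b.1, Sum.inl b.2) : Idx (fine Lc M') (Fib d))))ᵀ)
    (hZmm : ∀ b b', (Wz b b').submatrix (fun a : ↥(pbox M') × Fin (d + 1) => ((coarsePt M' Lc a.1, Sum.inr a.2) : Idx (fine Lc M') (Fib d)))
        (fun a : ↥(pbox M') × Fin (d + 1) => ((coarsePt M' Lc a.1, Sum.inr a.2) : Idx (fine Lc M') (Fib d))) = 0)
    (hZfm : ∀ b b', (Wz b b').submatrix (fun b : ↥(pbox (fine Lc M')) × Fin (d + 1) => ((b.1, Sum.inl b.2) : Idx (fine Lc M') (Fib d)))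
        (fun a : ↥(pbox M') × Fin (d + 1) => ((coarsePt M' Lc a.1, Sum.inr a.2) : Idx (fine Lc M') (Fib d)))
        = ((Wz b b').submatrix (fun a : ↥(pbox M') × Fin (d + 1) => ((coarsePt M' Lc a.1, Sum.inr a.2) : Idx (fine Lc M') (Fib d)))
            (fun b : ↥(pbox (fine Lc M')) × Fin (d + 1) => ((b.1, Sum.inl b.2) : Idx (fine Lc M') (Fib d))))ᵀ)
    -- the direction and the door's jets READ
    (v : ↥(pbox M') × Fin (d + 1) → ℝ)
    {H₁ H₂ : Matrix (↥(pbox (fine Lc M')) × Fin (d + 1)) (↥(pbox (fine Lc M')) × Fin (d + 1)) ℝ}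
    {Q₁₁ Q₁₂ : Matrix (↥(pbox M') × Fin (d + 1)) (↥(pbox (fine Lc M')) × Fin (d + 1)) ℝ}
    {Hz : Matrix (↥(pbox (fine Lc M')) × Fin (d + 1)) (↥(pbox (fine Lc M')) × Fin (d + 1)) ℝ} {Qz : Matrix (↥(pbox M') × Fin (d + 1)) (↥(pbox (fine Lc M')) × Fin (d + 1)) ℝ}
    (hH₁ : H₁ = (∑ b, v b • Dh b).submatrix (fun b : ↥(pbox (fine Lc M')) × Fin (d + 1) => ((b.1, Sum.inl b.2) : Idx (fine Lc M') (Fib d)))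
        (fun b : ↥(pbox (fine Lc M')) × Fin (d + 1) => ((b.1, Sum.inl b.2) : Idx (fine Lc M') (Fib d))))
    (hQ₁₁ : Q₁₁ = (∑ b, v b • Dh b).submatrix (fun a : ↥(pbox M') × Fin (d + 1) => ((coarsePt M' Lc a.1, Sum.inr a.2) : Idx (fine Lc M') (Fib d)))
        (fun b : ↥(pbox (fine Lc M')) × Fin (d + 1) => ((b.1, Sum.inl b.2) : Idx (fine Lc M') (Fib d))))
    (hH₂ : H₂ = (∑ b, ∑ b', (v b * v b') • Ws b b').submatrix (fun b : ↥(pbox (fine Lc M')) × Fin (d + 1) => ((b.1, Sum.inl b.2) : Idx (fine Lc M') (Fib d)))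
        (fun b : ↥(pbox (fine Lc M')) × Fin (d + 1) => ((b.1, Sum.inl b.2) : Idx (fine Lc M') (Fib d))))
    (hQ₁₂ : Q₁₂ = (∑ b, ∑ b', (v b * v b') • Ws b b').submatrix (fun a : ↥(pbox M') × Fin (d + 1) => ((coarsePt M' Lc a.1, Sum.inr a.2) : Idx (fine Lc M') (Fib d)))
        (fun b : ↥(pbox (fine Lc M')) × Fin (d + 1) => ((b.1, Sum.inl b.2) : Idx (fine Lc M') (Fib d))))
    (hHz : Hz = (∑ b, ∑ b', (v b * v b') • Wz b b').submatrix (fun b : ↥(pbox (fine Lc M')) × Fin (d + 1) => ((b.1, Sum.inl b.2) : Idx (fine Lc M') (Fib d)))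
        (fun b : ↥(pbox (fine Lc M')) × Fin (d + 1) => ((b.1, Sum.inl b.2) : Idx (fine Lc M') (Fib d))))
    (hQz : Qz = (∑ b, ∑ b', (v b * v b') • Wz b b').submatrix (fun a : ↥(pbox M') × Fin (d + 1) => ((coarsePt M' Lc a.1, Sum.inr a.2) : Idx (fine Lc M') (Fib d)))
        (fun b : ↥(pbox (fine Lc M')) × Fin (d + 1) => ((b.1, Sum.inl b.2) : Idx (fine Lc M') (Fib d))))
    (a₁ a₂ : ↥(pbox M') × Fin (d + 1)) :
    (cE₂ * wV4 d Lc (j + 1)) *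
      ((((-((-ΘL * H₁ - Ŝ * Q₁₁) * Γc - -ΘL * Q₁₁ᵀ * -ΘL) * H₁ + -ΘL * H₂
          - (((-ΘL * H₁ - Ŝ * Q₁₁) * Θ + -ΘL * Q₁₁ᵀ * Ŝ) * Q₁₁ + Ŝ * Q₁₂)) * Θ
        + (-ΘL * H₁ - Ŝ * Q₁₁) * (-((Γc * H₁ + Θ * Q₁₁) * Θ + Γc * Q₁₁ᵀ * Ŝ)))
      - ((-((-ΘL * H₁ - Ŝ * Q₁₁) * Γc - -ΘL * Q₁₁ᵀ * -ΘL) * (-Q₁₁ᵀ) + -ΘL * Q₁₂ᵀ) * Ŝ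
          + -ΘL * (-Q₁₁ᵀ) * ((-ΘL * H₁ - Ŝ * Q₁₁) * Θ + -ΘL * Q₁₁ᵀ * Ŝ)))
        - (ΘL * Hz * Θ + ΘL * Qzᵀ * Ŝ + Ŝ * Qz * Θ)) a₁ a₂
      + (cB * wB2 d Lc (j + 1))
          * ∑ b : ↥(pbox M') × Fin (d + 1), ∑ b' : ↥(pbox M') × Fin (d + 1), (v b * v b')
              * perF M' (dper M' (fun x z a c => ∑' n, tabs.vh₂S b.2 (b.1 : Site (d + 1)) b'.2 (translate M' (b'.1 : Site (d + 1)) n) x z a c))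
                  (a₁.1, Sum.inl a₁.2) (a₂.1, Sum.inl a₂.2)
      = ∑ b : ↥(pbox M') × Fin (d + 1), ∑ b' : ↥(pbox M') × Fin (d + 1), (v b * v b')
          * perF M' (dper M' (fun x z a c => ∑' n, T2RecOf d Lc (GcombSh Lc) (SpureCombOf tabs cE cVH cΛ) tabs.M cE₂ cB T tabs.vh₂S tabs.mixFF (j + 1)
              b.2 (b.1 : Site (d + 1)) b'.2 (translate M' (b'.1 : Site (d + 1)) n) x z a c)) (a₁.1, Sum.inl a₁.2) (a₂.1, Sum.inl a₂.2) := by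
  have hM : ∀ i, fine Lc M' i = Lc * M' i := fun i => rfl
  have hLM : ∀ i, Lc ∣ fine Lc M' i := fun i => ⟨M' i, rfl⟩
  -- part (a): the crown contracted, slots aligned with U21's coarse slots
  rw [sum_sum_perF_dper_tsum_T2comb_succ_inl_inl (fine Lc M') tabs cE cVH cΛ cE₂ cB T hM j v a₁.1 a₂.1 a₁.2 a₂.2, wrapPt_zsmul_eq_coarsePt,
    wrapPt_zsmul_eq_coarsePt]
  congr 1
  congr 1
  -- J2-live §4 with `X := D̂_v`, `Y := Ŵ^{slots}_vv`, and the symmetric-twin sandwich for `Ẑ_vv`; block equations from the sockets by linearity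
  have hY : ∑ b, ∑ b', (v b * v b') • Wh b b' = ∑ b, ∑ b', (v b * v b') • Ws b b' + ∑ b, ∑ b', (v b * v b') • Wz b b' := by
    rw [← Finset.sum_add_distrib]
    refine Finset.sum_congr rfl fun b _ => ?_
    rw [← Finset.sum_add_distrib]
    exact Finset.sum_congr rfl fun b' _ => by rw [hsplit, smul_add]
  rw [hWh] at hY
  beta_reduce at hY
  have hR : ∀ (A X Ys Yz : Matrix (Idx (fine Lc M') (Fib d)) (Idx (fine Lc M') (Fib d)) ℝ),
      (2 : ℝ) • (A * X * A * X * A) - A * (Ys + Yz) * A = ((2 : ℝ) • (A * X * A * X * A) - A * Ys * A) - A * Yz * A := fun A X Ys Yz => by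
    rw [Matrix.mul_add, Matrix.add_mul]; abel
  have hX := torus_thetaWord_eq_responseWord_comb (fine Lc M') hLM j (fun a : ↥(pbox M') × Fin (d + 1) => ((coarsePt M' Lc a.1, Sum.inr a.2) : Idx (fine Lc M') (Fib d)))
    (coarseSlot_injective M') (fun a => ⟨a.2, rfl⟩) (coarseSlot_range M')
    hΘ hΘL hŜ hΓc (∑ b, v b • Dh b) (∑ b, ∑ b', (v b * v b') • Ws b b') H₁ H₂ Q₁₁ Q₁₂ hH₁.symm ?_ hQ₁₁.symm ?_ hH₂.symm ?_ hQ₁₂.symm ?_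
  · have hZ := torus_sandwich_symmJet_comb (fine Lc M') hLM j (fun a : ↥(pbox M') × Fin (d + 1) => ((coarsePt M' Lc a.1, Sum.inr a.2) : Idx (fine Lc M') (Fib d)))
      (coarseSlot_injective M') (fun a => ⟨a.2, rfl⟩) (coarseSlot_range M')
      hΘ hΘL hŜ (∑ b, ∑ b', (v b * v b') • Wz b b') Hz Qz hHz.symm ?_ hQz.symm ?_
    · have hZ' := congrFun (congrFun hZ a₁) a₂
      have hX' := congrFun (congrFun hX a₁) a₂
      rw [hDh] at hX'
      simp only [Matrix.submatrix_apply] at hZ' hX'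
      rw [hY, hR, Matrix.sub_apply, hX', ← hZ']
      simp only [Matrix.sub_apply]
    · rw [hQz, submatrix_sum_sum_smul, submatrix_sum_sum_smul, Matrix.transpose_sum]
      refine Finset.sum_congr rfl fun b _ => ?_
      rw [Matrix.transpose_sum]
      exact Finset.sum_congr rfl fun b' _ => by rw [Matrix.transpose_smul, hZfm]
    · rw [submatrix_sum_sum_smul]
      exact Finset.sum_eq_zero fun b _ => Finset.sum_eq_zero fun b' _ => by rw [hZmm, smul_zero]
  · rw [hQ₁₁, submatrix_sum_smul, submatrix_sum_smul, Matrix.transpose_sum]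
    exact Finset.sum_congr rfl fun b _ => by rw [Matrix.transpose_smul, hDfm]
  · rw [submatrix_sum_smul]
    exact Finset.sum_eq_zero fun b _ => by rw [hDmm, smul_zero]
  · rw [hQ₁₂, submatrix_sum_sum_smul, submatrix_sum_sum_smul, Matrix.transpose_sum, ← Finset.sum_neg_distrib]
    refine Finset.sum_congr rfl fun b _ => ?_
    rw [Matrix.transpose_sum, ← Finset.sum_neg_distrib]
    exact Finset.sum_congr rfl fun b' _ => by rw [Matrix.transpose_smul, hWfm, smul_neg]
  · rw [submatrix_sum_sum_smul]
    exact Finset.sum_eq_zero fun b _ => Finset.sum_eq_zero fun b' _ => by rw [hWmm, smul_zero]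

end Assembly

end Summit.QuantumFields.BalabanUV.Beta.FP.CoarseJetOrderTwoGradedCombJunctionRecord

end
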